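import Summits.QuantumFields.QCD.Theorems.SpectralDefectExtinctionWindowExtinctionSpreadTelescope
import Summits.QuantumFields.QCD.Theorems.SpectralDefectExtinctionWindowExtinctionSpreadPattern
import Mathlib.MeasureTheory.Integral.Marginal
import Mathlib.MeasureTheory.Integral.Bochner.Set

/-!
# Conditional Littlewood–Offord under an `e^{±τ}` mixture of a product law — odds form

Helper for stub `stub_spreadFromParts` (S6, reshape r2) of line `free-volume-heavy-witness`
(crux `Summit.QuantumFields.QCD.Theses.SpectralDefectExtinction.WindowExtinction`,
item stmt-QuantumFields-8964).  Pure measure theory, no project vocabulary.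

`spread_fiber_atom_le_of_odds`: on the finite product `I → T` with the product `ν^{⊗I}` of a
probability measure, let `e^{φ}` be a weight which on the ACTIVE box `(Tp ∪ Tm)^I` is within
`e^{±τ}` of a product weight `e^{a} ∏ᵢ e^{bᵢ(tᵢ)}` whose factors oscillate by at most `B` on
`Tp ∪ Tm` (this only makes the one-coordinate masses finite and positive) and whose
one-coordinate ODDS are non-degenerate,
`ε ∫_{Tp ∪ Tm} e^{bᵢ} dν ≤ ∫_{Tp} e^{bᵢ} dν ≤ (1 - ε) ∫_{Tp ∪ Tm} e^{bᵢ} dν` (the form exported by the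
odds floor of the reshaped stub S5 — the constant `ε` is NOT tied to `B`), and let `X` be an integer
statistic which is EXACTLY additive (calibrated signs `+1` on `Tp`, `-1` on `Tm`) under single
refills of the coordinates of a finite set `S'`.  Then every atom of `X` carries at most the
fraction `e^{2τ} C/√(|S'|+1)` of the active mass, `C` the Littlewood–Offord constant at `ε`:
`∫_{active, X = j} e^{φ} ≤ e^{2τ} C/√(|S'|+1) ∫_{active} e^{φ}`.
Proof: Tonelli over the coordinates of `S'` (Mathlib `lmarginal`), exact additivity makes the
atom a pattern atom of independent signs in each fiber, Littlewood–Offord in product form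
(landed `spread_lo_product`); the odds hypothesis is read on the one-coordinate masses through
`integral_eq_lintegral_of_nonneg_ae`.
-/

noncomputable section

namespace Summit.QuantumFields.QCD.Cruxes.WindowExtinction.FreeVolumeHeavyWitness

open MeasureTheory Set Function
open scoped ENNReal BigOperators Classical

variable {I T : Type*} [Fintype I] [DecidableEq I] [MeasurableSpace T]

omit [Fintype I] [MeasurableSpace T] in
/-- Refilling the coordinates of `S'` lands in the active box iff the refill is active, provided
the other coordinates are active. -/
theorem spread_odds_updateFinset_mem_pi_iff {A : Set T} {S' : Finset I} {r : I → T}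
    (hr : ∀ i, i ∉ S' → r i ∈ A) (q : ↥S' → T) :
    updateFinset r S' q ∈ Set.pi Set.univ (fun _ : I => A) ↔ ∀ i : ↥S', q i ∈ A := by
  constructor
  · intro h i
    have := h i.1 (mem_univ _)
    simpa [updateFinset, i.2] using this
  · intro h i _
    by_cases hi : i ∈ S'
    · simpa [updateFinset, hi] using h ⟨i, hi⟩
    · simpa [updateFinset, hi] using hr i hi

omit [MeasurableSpace T] in
/-- A product over all coordinates of a refilled configuration splits into the refilled factors
and a constant. -/
theorem spread_odds_prod_updateFinset {M : Type*} [CommMonoid M] (F : I → T → M) (S' : Finset I)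
    (r : I → T) (q : ↥S' → T) :
    ∏ i, F i (updateFinset r S' q i) = (∏ i : ↥S', F i (q i)) * ∏ i ∈ S'ᶜ, F i (r i) := by
  rw [← Finset.prod_mul_prod_compl S' (fun i => F i (updateFinset r S' q i)), ← Finset.prod_coe_sort]
  congr 1
  · exact Finset.prod_congr rfl fun i _ => by simp [updateFinset, i.2]
  · exact Finset.prod_congr rfl fun i hi => by
      simp [updateFinset, (Finset.mem_compl.1 hi)]

omit [Fintype I] in
/-- Pulling a finite constant out of an `lmarginal`. -/
theorem spread_odds_lmarginal_const_mul (ν : Measure T) [SigmaFinite ν] (S' : Finset I) (c : ℝ≥0∞)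
    (hc : c ≠ ∞) (f : (I → T) → ℝ≥0∞) (r : I → T) :
    lmarginal (fun _ : I => ν) S' (fun t => c * f t) r = c * lmarginal (fun _ : I => ν) S' f r := by
  simp only [lmarginal]
  exact lintegral_const_mul' c _ hc

/-- **Conditional Littlewood–Offord under an `e^{±τ}` mixture, odds form** (see the module
docstring). -/
theorem spread_fiber_atom_le_of_odds :
    ∀ {I T : Type*} [Fintype I] [DecidableEq I] [MeasurableSpace T]
      (ν : Measure T) [IsProbabilityMeasure ν] {Tp Tm : Set T},
      MeasurableSet Tp → MeasurableSet Tm → Disjoint Tp Tm → ν Tp ≠ 0 →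
      ∀ {ε C : ℝ},
      (∀ (N : ℕ) (p : Fin N → ℝ), (∀ i, ε ≤ p i ∧ p i ≤ 1 - ε) → ∀ k : ℤ,
        (∑ s ∈ (Finset.univ : Finset (Fin N → Bool)).filter
            (fun s => (∑ i, (if s i then (1 : ℤ) else -1)) = k),
          ∏ i, (if s i then p i else 1 - p i)) ≤ C / Real.sqrt (N + 1)) →
      ∀ {φ : (I → T) → ℝ}, Measurable φ → ∀ {a τ B : ℝ} {b : I → T → ℝ},
      (∀ i, Measurable (b i)) →
      (∀ t : I → T, (∀ i, t i ∈ Tp ∪ Tm) → |φ t - a - ∑ i, b i (t i)| ≤ τ) →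
      (∀ i u u', u ∈ Tp ∪ Tm → u' ∈ Tp ∪ Tm → b i u ≤ b i u' + B) →
      (∀ i, ε * ∫ u in Tp ∪ Tm, Real.exp (b i u) ∂ν ≤ ∫ u in Tp, Real.exp (b i u) ∂ν ∧
        ∫ u in Tp, Real.exp (b i u) ∂ν ≤ (1 - ε) * ∫ u in Tp ∪ Tm, Real.exp (b i u) ∂ν) →
      ∀ {X : (I → T) → ℤ}, Measurable X → ∀ (S' : Finset I),
      (∀ t : I → T, (∀ i, t i ∈ Tp ∪ Tm) → ∀ i ∈ S', ∀ u ∈ Tp ∪ Tm,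
        X (Function.update t i u) - X t =
          (if u ∈ Tp then (1 : ℤ) else if u ∈ Tm then -1 else 0) -
            (if t i ∈ Tp then (1 : ℤ) else if t i ∈ Tm then -1 else 0)) →
      ∀ (j : ℤ),
      ∫⁻ t, (Set.pi Set.univ fun _ : I => Tp ∪ Tm).indicator
          (fun t => if X t = j then ENNReal.ofReal (Real.exp (φ t)) else 0) t
          ∂Measure.pi (fun _ : I => ν) ≤
        ENNReal.ofReal (Real.exp (2 * τ) * C / Real.sqrt (S'.card + 1)) *
          ∫⁻ t, (Set.pi Set.univ fun _ : I => Tp ∪ Tm).indicator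
            (fun t => ENNReal.ofReal (Real.exp (φ t))) t ∂Measure.pi (fun _ : I => ν) := by
  intro I T _ _ _ ν _ Tp Tm hTp hTm hdisj hTp0 ε C hLO φ hφm a τ B b hbm hφ hb hodds X hXm S' hX j
  -- notation
  set Box : Set (I → T) := Set.pi Set.univ fun _ : I => Tp ∪ Tm with hBox_def
  set F : I → T → ℝ≥0∞ := fun i u => ENNReal.ofReal (Real.exp (b i u)) with hF_def
  set sgn : T → ℤ := fun u => if u ∈ Tp then (1 : ℤ) else if u ∈ Tm then -1 else 0 with hsgn_def
  set g1 : (I → T) → ℝ≥0∞ := Box.indicator fun t => if X t = j then ∏ i, F i (t i) else 0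
    with hg1_def
  set g0 : (I → T) → ℝ≥0∞ := Box.indicator fun t => ∏ i, F i (t i) with hg0_def
  set c : ℝ≥0∞ := ENNReal.ofReal (C / Real.sqrt (S'.card + 1)) with hc_def
  have hC1 : 1 ≤ C := spread_lo_const_ge_one hLO
  have hC0 : 0 ≤ C := zero_le_one.trans hC1
  -- measurability
  have hBox : MeasurableSet Box := MeasurableSet.univ_pi fun _ => hTp.union hTm
  have hF : ∀ i, Measurable (F i) := fun i => (hbm i).exp.ennreal_ofReal
  have hprod : Measurable fun t : I → T => ∏ i, F i (t i) :=
    Finset.measurable_prod _ fun i _ => (hF i).comp (measurable_pi_apply i)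
  have hXj : MeasurableSet {t : I → T | X t = j} := hXm (measurableSet_singleton j)
  have hg1m : Measurable g1 := (Measurable.ite hXj hprod measurable_const).indicator hBox
  have hg0m : Measurable g0 := hprod.indicator hBox
  have hρm : Measurable fun t : I → T => ENNReal.ofReal (Real.exp (φ t)) := hφm.exp.ennreal_ofReal
  -- a reference active value
  obtain ⟨u₀, hu₀⟩ : Tp.Nonempty := nonempty_of_measure_ne_zero hTp0
  have hu₀' : u₀ ∈ Tp ∪ Tm := Or.inl hu₀
  ------------------------------------------------------------------
  -- Step A: the weight is below `e^{τ+a} ∏ F` on the active box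
  ------------------------------------------------------------------
  have hexp_prod : ∀ t : I → T, ENNReal.ofReal (Real.exp (∑ i, b i (t i))) = ∏ i, F i (t i) := by
    intro t
    rw [Real.exp_sum, ENNReal.ofReal_prod_of_nonneg fun i _ => (Real.exp_pos _).le]
  have hA : ∀ t, Box.indicator (fun t => if X t = j then ENNReal.ofReal (Real.exp (φ t)) else 0) t ≤
      ENNReal.ofReal (Real.exp (τ + a)) * g1 t := by
    intro t
    by_cases ht : t ∈ Box
    · rw [hg1_def, indicator_of_mem ht, indicator_of_mem ht]
      by_cases hj : X t = j
      · rw [if_pos hj, if_pos hj, ← hexp_prod, ← ENNReal.ofReal_mul (Real.exp_pos _).le,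
          ← Real.exp_add]
        refine ENNReal.ofReal_le_ofReal (Real.exp_le_exp.2 ?_)
        have := (abs_le.1 (hφ t fun i => ht i (mem_univ _))).2
        linarith
      · rw [if_neg hj, if_neg hj]; exact zero_le
    · rw [hg1_def, indicator_of_notMem ht, indicator_of_notMem ht]; exact zero_le
  ------------------------------------------------------------------
  -- Step C: `∏ F` is below `e^{τ-a} e^{φ}` on the active box
  ------------------------------------------------------------------
  have hCstep : ∀ t, g0 t ≤ ENNReal.ofReal (Real.exp (τ - a)) *
      Box.indicator (fun t => ENNReal.ofReal (Real.exp (φ t))) t := by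
    intro t
    by_cases ht : t ∈ Box
    · rw [hg0_def, indicator_of_mem ht, indicator_of_mem ht, ← hexp_prod,
        ← ENNReal.ofReal_mul (Real.exp_pos _).le, ← Real.exp_add]
      refine ENNReal.ofReal_le_ofReal (Real.exp_le_exp.2 ?_)
      have := (abs_le.1 (hφ t fun i => ht i (mem_univ _))).1
      linarith
    · rw [hg0_def, indicator_of_notMem ht, indicator_of_notMem ht]; exact zero_le
  ------------------------------------------------------------------
  -- Step B: the core, `∫ g1 ≤ c ∫ g0`, fiberwise over the coordinates of `S'`
  ------------------------------------------------------------------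
  have hB : ∫⁻ t, g1 t ∂Measure.pi (fun _ : I => ν) ≤ c * ∫⁻ t, g0 t ∂Measure.pi (fun _ : I => ν) := by
    set t₀ : I → T := fun _ => u₀ with ht₀
    have huniv : (Finset.univ : Finset I) = (Finset.univ \ S') ∪ S' :=
      (Finset.sdiff_union_of_subset (Finset.subset_univ S')).symm
    have hdj : Disjoint (Finset.univ \ S') S' := Finset.sdiff_disjoint
    rw [lintegral_eq_lmarginal_univ t₀, lintegral_eq_lmarginal_univ t₀, huniv,
      lmarginal_union _ g1 hg1m hdj, lmarginal_union _ g0 hg0m hdj,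
      ← spread_odds_lmarginal_const_mul ν _ c ENNReal.ofReal_ne_top]
    refine lmarginal_mono (fun r => ?_) t₀
    -- the fiber over `r`
    change ∫⁻ q, g1 (updateFinset r S' q) ∂Measure.pi (fun _ : ↥S' => ν) ≤
      c * ∫⁻ q, g0 (updateFinset r S' q) ∂Measure.pi (fun _ : ↥S' => ν)
    by_cases hr : ∀ i, i ∉ S' → r i ∈ Tp ∪ Tm
    swap
    · -- some frozen coordinate is inactive: the fiber misses the active box
      have hzero : ∀ q : ↥S' → T, g1 (updateFinset r S' q) = 0 := by
        intro q
        push Not at hr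
        obtain ⟨i, hi, hri⟩ := hr
        refine indicator_of_notMem (fun h => hri ?_) _
        have := h i (mem_univ _)
        simpa [updateFinset, hi] using this
      simp only [hzero, lintegral_const, zero_mul, zero_le]
    -- all frozen coordinates are active
    set BoxS : Set (↥S' → T) := Set.pi Set.univ fun _ : ↥S' => Tp ∪ Tm with hBoxS_def
    set cst : ℝ≥0∞ := ∏ i ∈ S'ᶜ, F i (r i) with hcst_def
    -- an active base configuration and the offset of `X`
    set q₀ : ↥S' → T := fun _ => u₀ with hq₀
    set rr : I → T := updateFinset r S' q₀ with hrr
    have hrr_act : ∀ i, rr i ∈ Tp ∪ Tm := by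
      intro i
      by_cases hi : i ∈ S'
      · simp [hrr, updateFinset, hi, hq₀, hu₀']
      · simpa [hrr, updateFinset, hi] using hr i hi
    set cX : ℤ := X rr - ∑ i : ↥S', sgn (rr i) with hcX
    have hexact : ∀ q : ↥S' → T, (∀ i, q i ∈ Tp ∪ Tm) →
        X (updateFinset r S' q) = cX + ∑ i : ↥S', sgn (q i) := by
      intro q hq
      have h1 : updateFinset r S' q = updateFinset rr S' q := by
        rw [hrr, updateFinset_updateFinset_of_subset (subset_refl S')]
      have h2 := spread_exact_updateFinset X sgn (Tp ∪ Tm) S'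
        (fun t ht i hi u hu => hX t ht i hi u hu) rr hrr_act q hq
      rw [h1, h2, hcX, Finset.sum_sub_distrib]
      ring
    -- the integrands in the fiber
    have hmemS : ∀ q : ↥S' → T, updateFinset r S' q ∈ Box ↔ q ∈ BoxS := fun q => by
      rw [hBox_def, spread_odds_updateFinset_mem_pi_iff hr q]
      exact ⟨fun h i _ => h i, fun h i => h i (mem_univ _)⟩
    have hg1_fiber : ∀ q : ↥S' → T, g1 (updateFinset r S' q) =
        BoxS.indicator (fun q => if (∑ i : ↥S', sgn (q i)) = j - cX
          then ∏ i : ↥S', F i (q i) else 0) q * cst := by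
      intro q
      by_cases hq : q ∈ BoxS
      · rw [hg1_def, indicator_of_mem ((hmemS q).2 hq), indicator_of_mem hq,
          hexact q fun i => hq i (mem_univ _), spread_odds_prod_updateFinset]
        have : (cX + ∑ i : ↥S', sgn (q i) = j) ↔ (∑ i : ↥S', sgn (q i) = j - cX) := by
          constructor <;> intro h <;> linarith
        simp only [this, ite_mul, zero_mul, hcst_def]
      · rw [hg1_def, indicator_of_notMem (fun h => hq ((hmemS q).1 h)), indicator_of_notMem hq,
          zero_mul]
    have hg0_fiber : ∀ q : ↥S' → T, g0 (updateFinset r S' q) =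
        BoxS.indicator (fun q => ∏ i : ↥S', F i (q i)) q * cst := by
      intro q
      by_cases hq : q ∈ BoxS
      · rw [hg0_def, indicator_of_mem ((hmemS q).2 hq), indicator_of_mem hq,
          spread_odds_prod_updateFinset]
      · rw [hg0_def, indicator_of_notMem (fun h => hq ((hmemS q).1 h)), indicator_of_notMem hq,
          zero_mul]
    -- pattern sums
    have hFS : ∀ i : ↥S', Measurable (F i) := fun i => hF i
    set G : ↥S' → Bool → ℝ≥0∞ := fun i bb => ∫⁻ u, (if bb then Tp else Tm).indicator (F i) u ∂ν
      with hG_def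
    have hBoxS : MeasurableSet BoxS := MeasurableSet.univ_pi fun _ => hTp.union hTm
    have hsgn_m : Measurable sgn :=
      Measurable.ite hTp measurable_const (Measurable.ite hTm measurable_const measurable_const)
    have hprodS : Measurable fun q : ↥S' → T => ∏ i : ↥S', F i (q i) :=
      Finset.measurable_prod (f := fun (i : ↥S') (q : ↥S' → T) => F i (q i)) _
        fun i _ => (hFS i).comp (measurable_pi_apply i)
    have hsumS : Measurable fun q : ↥S' → T => ∑ i : ↥S', sgn (q i) :=
      Finset.measurable_sum (f := fun (i : ↥S') (q : ↥S' → T) => sgn (q i)) _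
        fun i _ => hsgn_m.comp (measurable_pi_apply i)
    have hmeas1 : Measurable fun q : ↥S' → T => BoxS.indicator (fun q =>
        if (∑ i : ↥S', sgn (q i)) = j - cX then ∏ i : ↥S', F i (q i) else 0) q :=
      (Measurable.ite (hsumS (measurableSet_singleton _)) hprodS measurable_const).indicator hBoxS
    have hmeas0 : Measurable fun q : ↥S' → T => BoxS.indicator (fun q => ∏ i : ↥S', F i (q i)) q :=
      hprodS.indicator hBoxS
    have hI1 : ∫⁻ q, g1 (updateFinset r S' q) ∂Measure.pi (fun _ : ↥S' => ν) =
        (∑ σ ∈ (Finset.univ : Finset (↥S' → Bool)).filter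
            (fun σ => (∑ i, (if σ i then (1 : ℤ) else -1)) = j - cX), ∏ i, G i (σ i)) * cst := by
      simp_rw [hg1_fiber]
      rw [lintegral_mul_const _ hmeas1, hBoxS_def]
      simp only [hsgn_def]
      rw [spread_lintegral_pattern_atom ν hTp hTm hdisj hFS (j - cX)]
    have hI0 : ∫⁻ q, g0 (updateFinset r S' q) ∂Measure.pi (fun _ : ↥S' => ν) =
        (∑ σ : ↥S' → Bool, ∏ i, G i (σ i)) * cst := by
      simp_rw [hg0_fiber]
      rw [lintegral_mul_const _ hmeas0, hBoxS_def, spread_lintegral_pattern_total ν hTp hTm hdisj hFS]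
    -- finiteness and the real weights
    have hbound : ∀ (i : I) (u : T), u ∈ Tp ∪ Tm →
        ENNReal.ofReal (Real.exp (b i u₀ - B)) ≤ F i u ∧
          F i u ≤ ENNReal.ofReal (Real.exp (b i u₀ + B)) := by
      intro i u hu
      have h1 := hb i u₀ u hu₀' hu
      have h2 := hb i u u₀ hu hu₀'
      exact ⟨ENNReal.ofReal_le_ofReal (Real.exp_le_exp.2 (by linarith)),
        ENNReal.ofReal_le_ofReal (Real.exp_le_exp.2 (by linarith))⟩
    have hGbounds : ∀ (i : ↥S') (bb : Bool),
        ENNReal.ofReal (Real.exp (b i u₀ - B)) * ν (if bb then Tp else Tm) ≤ G i bb ∧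
          G i bb ≤ ENNReal.ofReal (Real.exp (b i u₀ + B)) * ν (if bb then Tp else Tm) := by
      intro i bb
      have hTb : MeasurableSet (if bb then Tp else Tm) := by cases bb <;> simp [hTp, hTm]
      have hsub : (if bb then Tp else Tm) ⊆ Tp ∪ Tm := by
        cases bb
        · exact subset_union_right
        · exact subset_union_left
      constructor
      · rw [hG_def]
        simp only
        rw [lintegral_indicator hTb, ← setLIntegral_const]
        exact setLIntegral_mono (hF i) fun u hu => (hbound i u (hsub hu)).1
      · rw [hG_def]
        simp only
        rw [lintegral_indicator hTb, ← setLIntegral_const]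
        exact setLIntegral_mono measurable_const fun u hu => (hbound i u (hsub hu)).2
    have hGfin : ∀ (i : ↥S') (bb : Bool), G i bb ≠ ∞ := fun i bb =>
      ne_top_of_le_ne_top (ENNReal.mul_ne_top ENNReal.ofReal_ne_top (measure_ne_top _ _))
        (hGbounds i bb).2
    set w : ↥S' → Bool → ℝ := fun i bb => (G i bb).toReal with hw_def
    have hGw : ∀ i bb, G i bb = ENNReal.ofReal (w i bb) := fun i bb =>
      (ENNReal.ofReal_toReal (hGfin i bb)).symm
    have hw0 : ∀ i bb, 0 ≤ w i bb := fun i bb => ENNReal.toReal_nonneg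
    have hwG : ∀ i bb, w i bb = (G i bb).toReal := fun _ _ => rfl
    -- positivity of the one-coordinate masses (from the oscillation bound)
    have hmp : 0 < (ν Tp).toReal := ENNReal.toReal_pos hTp0 (measure_ne_top _ _)
    have hwpos : ∀ i : ↥S', 0 < w i true + w i false := by
      intro i
      have h1 := ENNReal.toReal_mono (hGfin i true) (hGbounds i true).1
      rw [ENNReal.toReal_mul, ENNReal.toReal_ofReal (Real.exp_pos _).le, ← hwG] at h1
      simp only [if_true] at h1
      have : 0 < Real.exp (b i u₀ - B) * (ν Tp).toReal := mul_pos (Real.exp_pos _) hmp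
      linarith [hw0 i false]
    -- the one-coordinate masses are the set integrals of `e^{b i}`
    have hG_set : ∀ (i : ↥S') (A : Set T), MeasurableSet A →
        (∫⁻ u, A.indicator (F i) u ∂ν).toReal = ∫ u in A, Real.exp (b i u) ∂ν := by
      intro i A hA
      rw [lintegral_indicator hA, integral_eq_lintegral_of_nonneg_ae
        (Filter.Eventually.of_forall fun u => (Real.exp_pos (b i u)).le)
        (hbm i).exp.aestronglyMeasurable]
    have hG_t : ∀ i : ↥S', G i true = ∫⁻ u, Tp.indicator (F i) u ∂ν := fun i => by
      simp only [hG_def, if_true]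
    have hG_f : ∀ i : ↥S', G i false = ∫⁻ u, Tm.indicator (F i) u ∂ν := fun i => by
      simp only [hG_def, Bool.false_eq_true, if_false]
    have hw_t : ∀ i : ↥S', w i true = ∫ u in Tp, Real.exp (b i u) ∂ν := fun i => by
      rw [hwG, hG_t, hG_set i Tp hTp]
    have hw_u : ∀ i : ↥S', ∫ u in Tp ∪ Tm, Real.exp (b i u) ∂ν = w i true + w i false := by
      intro i
      have h1 : ∫⁻ u, (Tp ∪ Tm).indicator (F i) u ∂ν = G i true + G i false := by
        rw [hG_t, hG_f, lintegral_indicator (hTp.union hTm), lintegral_union hTm hdisj,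
          lintegral_indicator hTp, lintegral_indicator hTm]
      rw [← hG_set i (Tp ∪ Tm) (hTp.union hTm), h1,
        ENNReal.toReal_add (hGfin i true) (hGfin i false), hwG, hwG]
    -- non-degeneracy of the induced signs, from the odds hypothesis
    have hratio : ∀ i : ↥S', ε ≤ w i true / (w i true + w i false) ∧
        w i true / (w i true + w i false) ≤ 1 - ε := by
      intro i
      obtain ⟨h1, h2⟩ := hodds i
      rw [hw_u i, ← hw_t i] at h1 h2
      exact ⟨(le_div_iff₀ (hwpos i)).2 h1, (div_le_iff₀ (hwpos i)).2 h2⟩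
    -- Littlewood–Offord in product form
    have hLOw := spread_lo_product hLO w hwpos hratio (j - cX)
    have hfull := spread_sum_pattern_prod w
    rw [Fintype.card_coe] at hLOw
    -- back to `ℝ≥0∞`
    have hsumG : ∀ K : Finset (↥S' → Bool),
        ∑ σ ∈ K, ∏ i, G i (σ i) = ENNReal.ofReal (∑ σ ∈ K, ∏ i, w i (σ i)) := by
      intro K
      rw [ENNReal.ofReal_sum_of_nonneg fun σ _ => Finset.prod_nonneg fun i _ => hw0 i (σ i)]
      refine Finset.sum_congr rfl fun σ _ => ?_
      rw [ENNReal.ofReal_prod_of_nonneg fun i _ => hw0 i (σ i)]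
      exact Finset.prod_congr rfl fun i _ => hGw i (σ i)
    have hkey : (∑ σ ∈ (Finset.univ : Finset (↥S' → Bool)).filter
          (fun σ => (∑ i, (if σ i then (1 : ℤ) else -1)) = j - cX), ∏ i, G i (σ i)) ≤
        c * ∑ σ : ↥S' → Bool, ∏ i, G i (σ i) := by
      rw [hsumG, hsumG, hc_def, ← ENNReal.ofReal_mul (div_nonneg hC0 (Real.sqrt_nonneg _))]
      refine ENNReal.ofReal_le_ofReal ?_
      rw [hfull]
      exact hLOw
    rw [hI1, hI0, ← mul_assoc]
    exact mul_le_mul_left hkey cst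
  ------------------------------------------------------------------
  -- assembling A, B, C
  ------------------------------------------------------------------
  have hA' : ∫⁻ t, Box.indicator (fun t => if X t = j then ENNReal.ofReal (Real.exp (φ t)) else 0) t
      ∂Measure.pi (fun _ : I => ν) ≤
      ENNReal.ofReal (Real.exp (τ + a)) * ∫⁻ t, g1 t ∂Measure.pi (fun _ : I => ν) := by
    rw [← lintegral_const_mul _ hg1m]
    exact lintegral_mono hA
  have hC' : ∫⁻ t, g0 t ∂Measure.pi (fun _ : I => ν) ≤
      ENNReal.ofReal (Real.exp (τ - a)) *
        ∫⁻ t, Box.indicator (fun t => ENNReal.ofReal (Real.exp (φ t))) t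
          ∂Measure.pi (fun _ : I => ν) := by
    rw [← lintegral_const_mul _ (hρm.indicator hBox)]
    exact lintegral_mono hCstep
  have hconst : ENNReal.ofReal (Real.exp (τ + a)) * (c * ENNReal.ofReal (Real.exp (τ - a))) =
      ENNReal.ofReal (Real.exp (2 * τ) * C / Real.sqrt (S'.card + 1)) := by
    rw [hc_def, ← ENNReal.ofReal_mul (div_nonneg hC0 (Real.sqrt_nonneg _)),
      ← ENNReal.ofReal_mul (Real.exp_pos _).le]
    congr 1
    have : Real.exp (2 * τ) = Real.exp (τ + a) * Real.exp (τ - a) := by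
      rw [← Real.exp_add]; ring_nf
    rw [this]
    ring
  calc ∫⁻ t, Box.indicator (fun t => if X t = j then ENNReal.ofReal (Real.exp (φ t)) else 0) t
        ∂Measure.pi (fun _ : I => ν)
      ≤ ENNReal.ofReal (Real.exp (τ + a)) * ∫⁻ t, g1 t ∂Measure.pi (fun _ : I => ν) := hA'
    _ ≤ ENNReal.ofReal (Real.exp (τ + a)) * (c * ∫⁻ t, g0 t ∂Measure.pi (fun _ : I => ν)) :=
        mul_le_mul_right hB _
    _ ≤ ENNReal.ofReal (Real.exp (τ + a)) * (c * (ENNReal.ofReal (Real.exp (τ - a)) *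
          ∫⁻ t, Box.indicator (fun t => ENNReal.ofReal (Real.exp (φ t))) t
            ∂Measure.pi (fun _ : I => ν))) :=
        mul_le_mul_right (mul_le_mul_right hC' _) _
    _ = ENNReal.ofReal (Real.exp (2 * τ) * C / Real.sqrt (S'.card + 1)) *
          ∫⁻ t, Box.indicator (fun t => ENNReal.ofReal (Real.exp (φ t))) t
            ∂Measure.pi (fun _ : I => ν) := by
        rw [← hconst]; simp only [mul_assoc]

end Summit.QuantumFields.QCD.Cruxes.WindowExtinction.FreeVolumeHeavyWitness

end
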